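import Literature.Computability.AlgebraicComplexity.BI17FormsGenericNonNormalityProofs
import Literature.Computability.AlgebraicComplexity.BI17GenericQuarticSurfacePeriod
import HarnessLib

/-!
# BI 2017 Cor. 3.17 (2) at `(D, m) = (4, 4)`: the `GL₄`-orbit closure of a generic quartic surface
# form is NOT normal — unconditionally

Sibling proof file of `Literature/Computability/AlgebraicComplexity/BI17FundamentalInvariantForms.lean`
(cell `val-lit`, DAG row BI2017-A). Bürgisser–Ikenmeyer 2017 Cor. 3.17 (2): "Suppose `a'(D,m) = 1`
and let `w` be generic. Then `\overline{Gw}` is not normal if `D` is odd, or if `D` is even and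
`gcd(D,m) > 1`." At `(4, 4)`: `a'(4,4) = 1` is the tree theorem
`isZariskiGeneric_stabilizerPeriod_eq_one_four_four` (val-lit-p5, from `E(4,4) ∋ 4, 7`), `D = 4` is
even and `gcd(4,4) = 4 > 1`; this format is NOT in val-lit-t04's family `D = k m`, `k` even
(`isZariskiGeneric_not_isIntegrallyClosed_of_mul_even`). Proof by t04's Reynolds-free, polystability-free
core `not_isIntegrallyClosed_orbitCoordRing_of_consecutive` (BI Thm. 3.10): off `{F₆ F₇ = 0}` together
with the generic `a(w) = 1` and `w ≠ 0` we have `6, 7 ∈ E'(w)` (exact semi-invariance,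
`mem_exponentMonoid_of_aeval_ne_zero`) and `1 ∉ E'(w)` (else `b(w)·1 = 1 ∈ E(w)`,
`mul_mem_degreeMonoid_of_mem_exponentMonoid`, a non-zero invariant of degree `1`, excluded by `E(4,4)`).
Everything PROVED; no definitions, no facts; nothing here bears on `VP` versus `VNP`.
-/

noncomputable section

open MvPolynomial

namespace Literature.Computability.AlgebraicComplexity

/-- **BI 2017 Cor. 3.17 (2) at `(4, 4)`, unconditional: for almost all quaternary quartics `w`, the
orbit closure `\overline{GL₄ w}` is not normal** (`O(\overline{GL₄ w})` is not integrally closed).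
[cite: BurgisserIkenmeyer2017, Cor. 3.17 (2) (case D = m = 4) and Thm. 3.10] -/
theorem isZariskiGeneric_not_isIntegrallyClosed_orbitCoordRing_four_four :
    IsZariskiGeneric 4 fun w : MvPolynomial (Fin 4) ℂ => ¬ IsIntegrallyClosed (OrbitCoordRing w 4) := by
  classical
  obtain ⟨F₆, h₆d, h₆i, h₆0⟩ := exists_isSLInvariantCoord_four_four (d := 6)
    (by decide) (by decide) (by decide) (by decide) (by decide)
  obtain ⟨F₇, h₇d, h₇i, h₇0⟩ := exists_isSLInvariantCoord_four_four (d := 7)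
    (by decide) (by decide) (by decide) (by decide) (by decide)
  have hG : IsZariskiGeneric 4 fun w : MvPolynomial (Fin 4) ℂ =>
      aeval (formCoeff 4 w) F₆ ≠ 0 ∧ aeval (formCoeff 4 w) F₇ ≠ 0 :=
    IsZariskiGeneric.and ⟨F₆, h₆0, fun _ _ h => h⟩ ⟨F₇, h₇0, fun _ _ h => h⟩
  refine ((hG.and isZariskiGeneric_stabilizerPeriod_eq_one_four_four).and
    (isZariskiGeneric_ne_zero (by norm_num : 0 < 4) 4)).mono fun w hw h => ?_
  obtain ⟨⟨⟨h₆w, h₇w⟩, ha⟩, hw0⟩ := h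
  -- `6, 7 ∈ E'(w)`
  have h6 : 6 ∈ exponentMonoid 4 w :=
    mem_exponentMonoid_of_aeval_ne_zero (by norm_num) hw h₆d h₆i h₆w (by rw [ha])
  have h7 : 7 ∈ exponentMonoid 4 w :=
    mem_exponentMonoid_of_aeval_ne_zero (by norm_num) hw h₇d h₇i h₇w (by rw [ha])
  -- `b(w) = 1` from `4 b(w) = 4 a(w)` (eq. (3.1))
  have hb : degreePeriod 4 w = 1 := by
    have h31 := BI2017_eq_3_1 hw (by norm_num : 0 < 4)
    rw [ha] at h31
    omega
  -- `1 ∉ E'(w)`: else `1 ∈ E(w)`, a non-zero invariant of degree `1`, excluded by `E(4,4)`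
  have h1 : 1 ∉ exponentMonoid 4 w := by
    intro h1
    have hmem := mul_mem_degreeMonoid_of_mem_exponentMonoid (by norm_num : 0 < 4) hw hw0 h1
    rw [hb, mul_one] at hmem
    obtain ⟨F, hFh, hFi, hFI⟩ := hmem
    have hF0 : F ≠ 0 := by
      rintro rfl
      exact hFI (Ideal.zero_mem _)
    have hgen : (1 : ℕ) ∈ genericDegreeMonoid (Fin 4) ℂ 4 := ⟨F, hFh, hFi, hF0⟩
    rw [genericDegreeMonoid_four_four] at hgen
    exact hgen.1 rfl
  exact not_isIntegrallyClosed_orbitCoordRing_of_consecutive w (k := 6) (by norm_num) h6 h7 h1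

/-! ### The second conjunct of the named fact `BI2017_cor_3_17` at `(4, 4)` and `(3, 3)` -/

/-- **Cor. 3.17 (2) in the shape of the named fact's second conjunct, at `(D, m) = (4, 4)`** — holds
unconditionally (its conclusion is the theorem above; the printed hypotheses are carried and unused).
[cite: BurgisserIkenmeyer2017, Cor. 3.17 (2)] -/
theorem BI2017_cor_3_17_part2_clause_four_four :
    2 ≤ 4 → 2 ≤ 4 →
      IsZariskiGeneric 4 (fun f : MvPolynomial (Fin 4) ℂ => reducedStabilizerPeriod 4 f = 1) →
      (Odd 4 ∨ 1 < Nat.gcd 4 4) →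
      IsZariskiGeneric 4 fun f : MvPolynomial (Fin 4) ℂ => ¬ IsIntegrallyClosed (OrbitCoordRing f 4) :=
  fun _ _ _ _ => isZariskiGeneric_not_isIntegrallyClosed_orbitCoordRing_four_four

/-- **Cor. 3.17 (2) in the shape of the named fact's second conjunct, at `(D, m) = (3, 3)`** — holds:
its conclusion is the tree's `isZariskiGeneric_not_isIntegrallyClosed_orbitCoordRing_three_three`
(via Cor. 3.17 (1), `a(3,3) = 2 < 3`), although its hypothesis "`a'(3,3) = 1` generically" is false
(`not_isZariskiGeneric_reducedStabilizerPeriod_eq_one_three_three`). [cite: BurgisserIkenmeyer2017, Cor. 3.17 (2)] -/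
theorem BI2017_cor_3_17_part2_clause_three_three :
    2 ≤ 3 → 2 ≤ 3 →
      IsZariskiGeneric 3 (fun f : MvPolynomial (Fin 3) ℂ => reducedStabilizerPeriod 3 f = 1) →
      (Odd 3 ∨ 1 < Nat.gcd 3 3) →
      IsZariskiGeneric 3 fun f : MvPolynomial (Fin 3) ℂ => ¬ IsIntegrallyClosed (OrbitCoordRing f 3) :=
  fun _ _ _ _ => isZariskiGeneric_not_isIntegrallyClosed_orbitCoordRing_three_three

end Literature.Computability.AlgebraicComplexity

end
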